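import Mathlib
import HarnessLib
import Summits.NavierStokesRegularity.NavierStokesRegularity.Theses.ExtremalTypeIConstant
import Summits.NavierStokesRegularity.NavierStokesRegularity.Theses.DulacContraction
import Summits.NavierStokesRegularity.NavierStokesRegularity.Theorems.ExtremalTypeIConstantMinimiserExists
import Summits.NavierStokesRegularity.NavierStokesRegularity.Theorems.ExtremalTypeIConstantExtremalSpiralSymmetryPeriodToRDSS
import Summits.NavierStokesRegularity.NavierStokesRegularity.Theorems.ExtremalTypeIConstantExtremalSpiralSymmetryRdssLiouvilleOfInClass

/-!
# Crux `ExtremalSpiralSymmetry` (stmt-NavierStokesRegularity-8215), line `registered`: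
# the route target from Conjecture M's recurrence half and the RDSS wall (stmt-8561) ALONE

Support file (theorems only, `--supports stmt-NavierStokesRegularity-8215`; no definitions, no named facts). Lead c2.

The line's skeleton v5 cuts the crux `ExtremalSpiralSymmetry` into `stub_scalingRecurrence` (Conjecture M, recurrence
half: an EXTREMAL pair `(C, u)` of the KNSS-gauge class `A_C` has one scaling period `c ≠ 1` modulo a rigid motion
and a forward time shift), the landed `stub_periodToRDSS`, the wall `stub_rdssLiouville` (landed modulo crux
stmt-8561: `stub_rdssLiouville_of_rdssLiouvilleInClass`) and the landed generator machinery. This file records the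
STRUCTURAL CONSEQUENCE for the route: with the route's support `MinimiserExists` (stmt-8217, PROVED,
`extremalTypeIConstant_minimiserExists_proof`) the TARGET itself follows from the recurrence stub and the RDSS wall,
bypassing both the generator half of the crux and crux 3 (`SpiralScalingLiouville`, stmt-8216):

* `timeShift_pinned` — attainment pins the time shift of a period to `0` (the skeleton's pinning lemma: at the
  transported hot spot `(−1/c², 0)` the left side of `S_c u = g θ_δ u` has norm `cC`, the right side at most
  `C/√(1/c² + δ)`, so `c²δ ≤ 0`);
* `typeIAncientLiouville_of_scalingRecurrence_of_rdssLiouvilleInClass` —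
  `RDSSLiouvilleInClass → stub_scalingRecurrence → TypeIAncientLiouville` (stmt-8561 ∧ stub 1 ⇒ stmt-4050): a
  nontrivial element gives an extremal (`MinimiserExists`), which has a period (stub 1), pinned (`δ = 0`), centred
  to an RDSS identity with factor `> 1` (`stub_periodToRDSS`), hence vanishes (`stub_rdssLiouville_of_…`) —
  contradicting `‖w(−1,0)‖ = C⋆ > 0`;
* `extremalSpiralSymmetry_of_scalingRecurrence_of_rdssLiouvilleInClass` — in particular the crux (vacuously).

Together with the landed necessity `stub_scalingRecurrence_of_ExtremalSpiralSymmetry` (crux ⇒ stub 1): GIVEN the shared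
wall stmt-8561, crux stmt-8215 ⇔ its recurrence stub ⇔ (with 8217) the route target. Both theorems are CONDITIONAL on
stmt-8561 and on the open stub (explicit hypotheses, never asserted).
-/

noncomputable section

-- the summit and its single sub-problem share the name (CONVENTIONS §1), as in every Theorems file
set_option linter.dupNamespace false

open Set MeasureTheory Filter Topology
open Literature.Analysis.FluidPDE

namespace Summit.NavierStokesRegularity.NavierStokesRegularity.Theorems.ExtremalSpiralSymmetry.Registered

/-- **Pinning the time shift.** If the Type-I bound of `u` with constant `C > 0` is attained at `(−1, 0)` and
`c u(c²t, cx) = R u(t − δ, R⁻¹(x − b))` on `t < 0` with `c > 0`, `δ ≥ 0`, then `δ = 0`: at the transported hot spot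
`(−1/c², 0)` the left side has norm `cC`, the right side at most `C/√(1/c² + δ)`, whence `c²δ ≤ 0`. [folklore] -/
-- adapted from the line's skeleton Cruxes/ExtremalSpiralSymmetry/Lines/birth.lean (`timeShift_pinned`)
theorem timeShift_pinned {C : ℝ} {u : ℝ → EuclideanSpace ℝ (Fin 3) → EuclideanSpace ℝ (Fin 3)} (hC : 0 < C)
    (hI : Literature.Analysis.FluidPDE.HasTypeITimeDecay C u) (hnorm : ‖u (-1) 0‖ = C)
    {c δ : ℝ} (hc : 0 < c) (hδ : 0 ≤ δ) {b : EuclideanSpace ℝ (Fin 3)}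
    {R : EuclideanSpace ℝ (Fin 3) ≃ₗᵢ[ℝ] EuclideanSpace ℝ (Fin 3)}
    (heq : ∀ t < (0 : ℝ), ∀ x, c • u (c ^ 2 * t) (c • x) = R (u (t - δ) (R.symm (x - b)))) : δ = 0 := by
  have hc2 : 0 < c ^ 2 := by positivity
  have ht₀ : -(1 / c ^ 2) < (0 : ℝ) := neg_neg_of_pos (by positivity)
  have key := heq (-(1 / c ^ 2)) ht₀ 0
  have e1 : c ^ 2 * (-(1 / c ^ 2)) = -1 := by field_simp
  rw [e1, smul_zero] at key
  have hL : ‖c • u (-1) 0‖ = c * C := by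
    rw [norm_smul, Real.norm_of_nonneg hc.le, hnorm]
  have hs : -(1 / c ^ 2) - δ < 0 := by linarith
  have hR : ‖R (u (-(1 / c ^ 2) - δ) (R.symm (0 - b)))‖ ≤ C / Real.sqrt (-(-(1 / c ^ 2) - δ)) := by
    rw [LinearIsometryEquiv.norm_map]
    exact hI _ hs _
  rw [← key, hL] at hR
  have e2 : -(-(1 / c ^ 2) - δ) = 1 / c ^ 2 + δ := by ring
  rw [e2] at hR
  have hpos : 0 < 1 / c ^ 2 + δ := by positivity
  have hsq : 0 < Real.sqrt (1 / c ^ 2 + δ) := Real.sqrt_pos.2 hpos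
  have h3 : c * Real.sqrt (1 / c ^ 2 + δ) ≤ 1 := by
    rw [le_div_iff₀ hsq] at hR
    by_contra h
    push Not at h
    have : C * 1 < C * (c * Real.sqrt (1 / c ^ 2 + δ)) := mul_lt_mul_of_pos_left h hC
    nlinarith
  have h4 : c ^ 2 * (1 / c ^ 2 + δ) ≤ 1 := by
    have h3' : 0 ≤ c * Real.sqrt (1 / c ^ 2 + δ) := by positivity
    calc c ^ 2 * (1 / c ^ 2 + δ) = (c * Real.sqrt (1 / c ^ 2 + δ)) ^ 2 := by
          rw [mul_pow, Real.sq_sqrt hpos.le]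
      _ ≤ 1 := pow_le_one₀ h3' h3
  have e3 : c ^ 2 * (1 / c ^ 2 + δ) = 1 + c ^ 2 * δ := by
    field_simp
  rw [e3] at h4
  have h5 : c ^ 2 * δ ≤ 0 := by linarith
  have h6 : δ ≤ 0 := by
    by_contra h
    push Not at h
    have : 0 < c ^ 2 * δ := mul_pos hc2 h
    linarith
  exact le_antisymm h6 hδ

/-- **The route target from the recurrence stub and the RDSS wall.** Assume crux stmt-8561
(`DulacContraction.RDSSLiouvilleInClass`) and the line's registered stub `stub_scalingRecurrence` (statement verbatim,
as a hypothesis: every extremal pair has a scaling period modulo a rigid motion and a forward time shift). Then the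
route target `TypeIAncientLiouville` (stmt-4050) holds: a nontrivial element of some `A_C` yields an extremal pair
`(C⋆, w)` with `‖w(−1,0)‖ = C⋆ > 0` (`MinimiserExists`, proved); its period has `δ = 0` (`timeShift_pinned`), is RDSS
about a centre with factor `> 1` (`stub_periodToRDSS`), so `w ≡ 0` on `t < 0`
(`stub_rdssLiouville_of_rdssLiouvilleInClass`) — contradiction. CONDITIONAL on stmt-8561 and on the open stub.
[folklore] -/
theorem typeIAncientLiouville_of_scalingRecurrence_of_rdssLiouvilleInClass :
    _root_.Summit.NavierStokesRegularity.NavierStokesRegularity.Theses.DulacContraction.RDSSLiouvilleInClass →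
    (∀ (C : ℝ) (u : ℝ → EuclideanSpace ℝ (Fin 3) → EuclideanSpace ℝ (Fin 3)), 0 < C →
      (ContDiffOn ℝ (⊤ : ℕ∞) (Function.uncurry u) (Set.Iio 0 ×ˢ Set.univ) ∧
          (∀ t < 0, Literature.Analysis.FluidPDE.VectorCalculus.IsDivFree (u t)) ∧
          (∀ s t : ℝ, s < t → t < 0 → ∀ x, u t x =
            Literature.Analysis.FluidPDE.heatFlow (u s) (t - s) x -
              ∫ τ in Set.Ioo s t, ∫ y,
                Literature.Analysis.FluidPDE.oseenKernel (t - τ) (x - y) (u τ y) (u τ y)) ∧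
          Literature.Analysis.FluidPDE.HasTypeITimeDecay C u) ∧
        ‖u (-1) 0‖ = C ∧
        (∀ (C' : ℝ) (u' : ℝ → EuclideanSpace ℝ (Fin 3) → EuclideanSpace ℝ (Fin 3)),
          (ContDiffOn ℝ (⊤ : ℕ∞) (Function.uncurry u') (Set.Iio 0 ×ˢ Set.univ) ∧
            (∀ t < 0, Literature.Analysis.FluidPDE.VectorCalculus.IsDivFree (u' t)) ∧
            (∀ s t : ℝ, s < t → t < 0 → ∀ x, u' t x =
              Literature.Analysis.FluidPDE.heatFlow (u' s) (t - s) x -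
                ∫ τ in Set.Ioo s t, ∫ y,
                  Literature.Analysis.FluidPDE.oseenKernel (t - τ) (x - y) (u' τ y) (u' τ y)) ∧
            Literature.Analysis.FluidPDE.HasTypeITimeDecay C' u') →
          (∃ t < 0, ∃ x, u' t x ≠ 0) → C ≤ C') →
      ∃ c : ℝ, 0 < c ∧ c ≠ 1 ∧ ∃ (δ : ℝ) (b : EuclideanSpace ℝ (Fin 3))
        (R : EuclideanSpace ℝ (Fin 3) ≃ₗᵢ[ℝ] EuclideanSpace ℝ (Fin 3)), 0 ≤ δ ∧
        ∀ t < 0, ∀ x, c • u (c ^ 2 * t) (c • x) = R (u (t - δ) (R.symm (x - b)))) →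
    _root_.Summit.NavierStokesRegularity.NavierStokesRegularity.Theses.ExtremalTypeIConstant.TypeIAncientLiouville := by
  intro h8561 hrec C u hcls t ht x
  by_contra hne
  -- a nontrivial element gives an extremal pair
  obtain ⟨C', w, hC', hclsw, hnorm, hmin⟩ :=
    _root_.Summit.NavierStokesRegularity.NavierStokesRegularity.Theorems.extremalTypeIConstant_minimiserExists_proof
      ⟨C, u, hcls, t, ht, x, hne⟩
  -- the extremal has a scaling period, pinned to `δ = 0`
  obtain ⟨c, hc, hc1, δ, b, R, hδ, heq⟩ := hrec C' w hC' ⟨hclsw, hnorm, hmin⟩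
  have hδ0 : δ = 0 := timeShift_pinned hC' hclsw.2.2.2 hnorm hc hδ heq
  subst hδ0
  have heq' : ∀ s < (0 : ℝ), ∀ y, c • w (c ^ 2 * s) (c • y) = R (w s (R.symm (y - b))) := fun s hs y => by
    simpa only [sub_zero] using heq s hs y
  -- centre the period: RDSS with factor `> 1`, killed by the wall
  obtain ⟨c', R', x₀, hc', hrdss⟩ := stub_periodToRDSS w c b R hc hc1 heq'
  have h0 := stub_rdssLiouville_of_rdssLiouvilleInClass h8561 C' w c' R' x₀ hclsw hc' hrdss (-1)
    (by norm_num) 0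
  rw [h0, norm_zero] at hnorm
  exact absurd hnorm hC'.ne

/-- **The crux from the recurrence stub and the RDSS wall (vacuously).** Under stmt-8561 and the recurrence stub no
extremal pair exists (`typeIAncientLiouville_of_scalingRecurrence_of_rdssLiouvilleInClass` kills every element of
every `A_C`), so `ExtremalSpiralSymmetry` holds. With the landed necessity `stub_scalingRecurrence_of_ExtremalSpiralSymmetry`
(crux ⇒ stub): given stmt-8561, the crux is EQUIVALENT to its recurrence stub. CONDITIONAL on stmt-8561 and the stub.
[folklore] -/
theorem extremalSpiralSymmetry_of_scalingRecurrence_of_rdssLiouvilleInClass :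
    _root_.Summit.NavierStokesRegularity.NavierStokesRegularity.Theses.DulacContraction.RDSSLiouvilleInClass →
    (∀ (C : ℝ) (u : ℝ → EuclideanSpace ℝ (Fin 3) → EuclideanSpace ℝ (Fin 3)), 0 < C →
      (ContDiffOn ℝ (⊤ : ℕ∞) (Function.uncurry u) (Set.Iio 0 ×ˢ Set.univ) ∧
          (∀ t < 0, Literature.Analysis.FluidPDE.VectorCalculus.IsDivFree (u t)) ∧
          (∀ s t : ℝ, s < t → t < 0 → ∀ x, u t x =
            Literature.Analysis.FluidPDE.heatFlow (u s) (t - s) x -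
              ∫ τ in Set.Ioo s t, ∫ y,
                Literature.Analysis.FluidPDE.oseenKernel (t - τ) (x - y) (u τ y) (u τ y)) ∧
          Literature.Analysis.FluidPDE.HasTypeITimeDecay C u) ∧
        ‖u (-1) 0‖ = C ∧
        (∀ (C' : ℝ) (u' : ℝ → EuclideanSpace ℝ (Fin 3) → EuclideanSpace ℝ (Fin 3)),
          (ContDiffOn ℝ (⊤ : ℕ∞) (Function.uncurry u') (Set.Iio 0 ×ˢ Set.univ) ∧
            (∀ t < 0, Literature.Analysis.FluidPDE.VectorCalculus.IsDivFree (u' t)) ∧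
            (∀ s t : ℝ, s < t → t < 0 → ∀ x, u' t x =
              Literature.Analysis.FluidPDE.heatFlow (u' s) (t - s) x -
                ∫ τ in Set.Ioo s t, ∫ y,
                  Literature.Analysis.FluidPDE.oseenKernel (t - τ) (x - y) (u' τ y) (u' τ y)) ∧
            Literature.Analysis.FluidPDE.HasTypeITimeDecay C' u') →
          (∃ t < 0, ∃ x, u' t x ≠ 0) → C ≤ C') →
      ∃ c : ℝ, 0 < c ∧ c ≠ 1 ∧ ∃ (δ : ℝ) (b : EuclideanSpace ℝ (Fin 3))
        (R : EuclideanSpace ℝ (Fin 3) ≃ₗᵢ[ℝ] EuclideanSpace ℝ (Fin 3)), 0 ≤ δ ∧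
        ∀ t < 0, ∀ x, c • u (c ^ 2 * t) (c • x) = R (u (t - δ) (R.symm (x - b)))) →
    _root_.Summit.NavierStokesRegularity.NavierStokesRegularity.Theses.ExtremalTypeIConstant.ExtremalSpiralSymmetry := by
  intro h8561 hrec C u hC hext
  obtain ⟨hcls, hnorm, -⟩ := hext
  have h0 := typeIAncientLiouville_of_scalingRecurrence_of_rdssLiouvilleInClass h8561 hrec C u hcls (-1)
    (by norm_num) 0
  rw [h0, norm_zero] at hnorm
  exact absurd hnorm hC.ne

end Summit.NavierStokesRegularity.NavierStokesRegularity.Theorems.ExtremalSpiralSymmetry.Registered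

end
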